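import Mathlib
import Summits.Ventures.HodgeRepro2.T5DatumSimilitude

/-!
# T6N2Hyp — sub-step N2: the ONE display (TARGET-T6 §3 row N2; owner t6-p5, re-pointed l. 5070 (1))

N2's conclusion (b) — μ-admissibility of the four `ε_i`, `W_B ≅ W_A`, (H_χ) — is kernel arithmetic
on the explicit datum (p3's `T5DatumAssembly.lemma_N2_complete`: signs, the product identity
`e₁₀₁ e₁₁₀ = e₁₁₁ e₁₀₀`, the similitude, the equal signatures) EXCEPT the isometry `W_B ≅ W_A`
itself: the two rank-2 skew-hermitian spaces have the same determinant and the same signatures, but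
no isometry can be written down (a diagonal one would need the similitude scalar `u` to be a norm,
and `u` is negative at one real place). The isometry is therefore a printed input: LANDHERR'S
CLASSIFICATION of hermitian spaces over a number field by dimension, determinant class and
signatures (the record's rows N2.2.7 / N2.2.9: Gross 2021 Thm 3.1 + HKS96 pp. 942–943), displayed
here from the held PRINT with page numbers — G. Shimura, «Arithmetic of Hermitian Forms» (the
printed title), Doc. Math. 13 (2008), Theorem 2.2(i), p. 748 — in the datum's own vocabulary (the
diagonal forms `T5DatumSimilitude.pairForm c₁ c₂` on `K × K` with totally real coefficients,
Shimura's (1.2) convention). The skew-hermitian ⇄ hermitian translation (dividing `W_A`, `W_B` by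
`e₁₁₁`) and the sign bookkeeping are kernel work in T6N2Main. Statement lane: one `def … : Prop` and a `#check`.

README §8(d): uses an L-value-free non-vanishing device: NO (TIER5 §N2, a pre-02:16Z line of
record — N2 asserts no non-vanishing — continued).
-/

namespace Summit.Ventures.HodgeRepro2.T6.Hyp

open Summit.Ventures.HodgeRepro2.T5DatumSimilitude

/-- [cite: Shimura2008, G. Shimura, «Arithmetic of Hermitian Forms», Doc. Math. 13 (2008) 739–774,
Theorem 2.2(i), journal p. 748 (page layer paper:doi-10-4171-dm-258 p0010 ll. 26–27), with the
standing conventions of §1.1 p. 743 (p0005 ll. 18–28), §1.2 p. 744 (p0006 ll. 5–7) and §2.1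
pp. 747–748 (p0009 ll. 66–71, continued p0010 l. 5)] «Theorem 2.2. (i) The isomorphism class of
(V, ϕ) is determined by n, {σv }, and d0 (ϕ).» — where (§1.1) ‹Let V be a left K-module isomorphic
to K^n_1; we put then n = dim(V). By a hermitian space we mean a structure (V, ϕ), where ϕ is a
hermitian form on V, that is, an F-bilinear map ϕ : V × V → K such that (1.1) ϕ(x, y)^ρ = ϕ(y, x),
(1.2) ϕ(ax, by) = ab^ρ ϕ(x, y) for every a, b ∈ K. Whenever we speak of a hermitian space (V, ϕ),
we assume that ϕ is nondegenerate›, (§1.2) ‹Let ϕ0 be the matrix that represents ϕ with respect to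
a K-basis of V; then we denote by d0(V, ϕ) the element of F^×/N_{K/F}(K^×) represented by
(−1)^{n/2} det(ϕ0) or (−1)^{(n−1)/2} det(ϕ0) according as n is even or odd.›, and (§2.1, F a global
field, K a quadratic extension of F, ρ the nontrivial automorphism of K over F) ‹Let r0 denote the
set of all real archimedean primes of F that do not split in K. … For each fixed v ∈ r0 we have a
pair of nonnegative integers (pv, qv) such that ϕv is represented by diag[1_{pv}, −1_{qv}] when Fv
and Kv are identified with R and C. We put then sv(ϕ) = pv − qv, and call sv(ϕ) the index of ϕ at
v.› (the {σv} of the theorem are the values sv(ϕ), (2.1a)). [display: the theorem sentence is the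
layer's bytes («…»); the three standing blocks are READINGS (‹…›) of the layer's «Kn1 ;», «dim(V )»,
«F -bilinear», «ϕ(x, y)ρ», «d0 (V, ϕ)», «F × /NK/F (K × )», «(−1)n/2», «(pv , qv )»,
«diag[1pv , −1qv ]», «sv (ϕ) = pv − qv ,» with the sub/superscripts and spacing restored
(QA-t6lit-61: alnum-exact across the page break). K := the CM field
`K` of the N2 datum, F := its maximal real subfield, ρ := `star` (the CM conjugation; the totally
real elements are those with `star c = c`); n := 2, V := K × K, and ϕ, ϕ′ the hermitian forms given
by ORTHOGONAL BASES, `pairForm c₁ c₂ (x, y) (x′, y′) = x x′^ρ c₁ + y y′^ρ c₂` (p3's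
`T5DatumSimilitude.pairForm`, Shimura's (1.2) convention) with c₁, c₂, c₁′, c₂′ ∈ F^× — so
det(ϕ0) = c₁ c₂ and d0(ϕ) is the class of (−1)^{2/2} c₁ c₂; «d0(ϕ) = d0(ϕ′)» is rendered as
c₁ c₂ ≡ c₁′ c₂′ modulo N_{K/F}(K^×), i.e. ∃ z ≠ 0, c₁ c₂ = c₁′ c₂′ · z z^ρ. Every real place of F
lies in r0 (K is CM, totally complex over the totally real F), and a real place v of F is the
restriction of a conjugate pair (φ, φ̄) of complex embeddings of K, on which c ∈ F takes the real
value Re φ(c); for the diagonal form pv = #{i : φ(cᵢ) > 0}, qv = #{i : φ(cᵢ) < 0}, hence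
sv(ϕ) = sign φ(c₁) + sign φ(c₂) as an integer, and ‹sv(ϕ) = sv(ϕ′) for every v ∈ r0› is rendered as
the equality of these sums for EVERY complex embedding φ of K. «The isomorphism class … is
determined» = two hermitian spaces with the same (n, {σv}, d0) are isomorphic, an isomorphism of
hermitian spaces being a K-linear bijection carrying ϕ′ to ϕ: rendered as a K-linear automorphism g
of K × K with ϕ′(g v, g w) = ϕ(v, w). WEAKER than print: n = 2 only; the forms given by orthogonal
bases; only the ‹same invariants ⇒ isomorphic› content of (i); (ii) (existence) not displayed.]
[quote-audit: QA-t6lit-61 — the theorem quote BYTE-EXACT on the page layer; the standing blocks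
alnum-exact, set in ‹…› as readings (form fix applied in this v2; docstring only, the `def` body
byte-identical to v1 p402255)] -/
def Shimura2008_Thm2_2_i (K : Type*) [Field K] [NumberField K] [NumberField.IsCMField K] : Prop :=
  ∀ c₁ c₂ c₁' c₂' : K,
    star c₁ = c₁ → star c₂ = c₂ → star c₁' = c₁' → star c₂' = c₂' →
    c₁ ≠ 0 → c₂ ≠ 0 → c₁' ≠ 0 → c₂' ≠ 0 →
    (∃ z : K, z ≠ 0 ∧ c₁ * c₂ = c₁' * c₂' * (z * star z)) →
    (∀ φ : K →+* ℂ, (SignType.sign (φ c₁).re : ℤ) + SignType.sign (φ c₂).re =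
      (SignType.sign (φ c₁').re : ℤ) + SignType.sign (φ c₂').re) →
    ∃ g : (K × K) ≃ₗ[K] (K × K), ∀ v w, pairForm c₁' c₂' (g v) (g w) = pairForm c₁ c₂ v w

#check @Shimura2008_Thm2_2_i

end Summit.Ventures.HodgeRepro2.T6.Hyp
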